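import Summits.Ventures.MM22.Rank333.Census22
import HarnessLib

/-!
# MM22 venture — the STRATIFIED form of the `Census22` reduction (what a census complete only for `κ ≤ K` proves)

HONEST FRAMING (cell `pub-mm22`, seat p1 g7, 2026-08-23; theorem-only companion of `Census22.lean`, NO bound, no new
definitions).  The W5 census of record enumerates the HK7-legal valid 21-profiles of `⟨3,3,3⟩` over `𝔽₂` stratified by
an index `κ` (in the cell: `κ P` = the number `k` of first-factor patterns of rank `≥ 2` as `3 × 3` bit matrices),
and at the 2026-08-23 cut it is complete only for the strata `κ ≤ K` (`K = 2`, resp. `3`), every listed class being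
unrealizable, while the strata `κ ≥ 4` are known to be non-empty up to `κ = 9` with no completeness method in hand.
This file records, for an ARBITRARY stratification `κ : (Fin 21 → ℕ) → ℕ`, exactly what such a PARTIAL census proves
once its two computational hypotheses are supplied:

* `stratum_gt_of_stratified_census` — if every `Valid21 rows` profile with `κ ≤ K` is carried by a `GEquiv` chain onto
  a coordinate HK7 violation or onto a listed class (`hcomplete`, stratified completeness) and every listed class is
  unrealizable (`hnone`), then EVERY realizable profile of 21 nonzero 9-bit patterns has `κ ≥ K + 1` — with the cell's
  `κ`: a hypothetical 21-product `𝔽₂` scheme for `⟨3,3,3⟩` carries at least `K + 1` first-factor forms of rank `≥ 2`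
  (and, by the cyclic symmetry of `⟨3,3,3⟩`, on each of the other two factors; not restated here);
* `rankGe22_of_stratified_census_top` — the degenerate case: if in addition NO valid profile has `κ ≥ K + 1`
  (hypothesis `htop`, an empty top), the stratified census is a full census and `R_𝔽₂(⟨3,3,3⟩) ≥ 22` follows from
  `rankGe22_of_legal_census`.  At the 2026-08-23 cut `htop` is FALSE for the cell's `κ` and every `K ≤ 8` (valid
  classes with `k = 4, …, 7, 9` exist); the form is recorded only to make the logical shape explicit.

Nothing here is evidence that any hypothesis holds; the census lists, their completeness legs and the per-class
refutations live outside the kernel (the cell's DATA-CUT-0823.md).  Realizability invariance under `GEquiv` and the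
HK7 discharge are the tree's `realizable_of_gEquiv` / `not_realizable21_of_gEquiv_hk7` (Hopcroft–Kerr 1971, Lemma 7).
-/

namespace Summit.Ventures.MM22.Census22

open Summit.MatrixMultiplication.OmegaCensus.GF2RankLB
open Summit.Ventures.MM22.GF2Cert.Profile
open Summit.MatrixMultiplication.OmegaCensus
open Literature.Computability.AlgebraicComplexity

/-- **The stratified census reduction** (any stratification `κ` of the profiles).  `rows`/`hrows`: the census table as
kernel `Cert`s (read as LOWER bounds); `K`: the last complete stratum; `L`: the listed classes of the strata `κ ≤ K`;
`hcomplete`: every valid profile with `κ ≤ K` is `GEquiv`-carried onto a coordinate HK7 violation or onto a listed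
class; `hnone`: every listed class is unrealizable.  CONCLUSION: every realizable profile `P` of 21 nonzero 9-bit
patterns has `K + 1 ≤ κ P`.  (Pure logic on top of `rowsOK_of_realizable21`, `realizable_of_gEquiv`,
`not_realizable21_of_gEquiv_hk7`; no invariance of `κ` under `GEquiv` is needed or claimed.) -/
theorem stratum_gt_of_stratified_census (κ : (Fin 21 → ℕ) → ℕ) (rows : List (List ℕ × ℕ))
    (hrows : ∀ r ∈ rows, Cert 3 3 3 r.1 r.2) (K : ℕ) (L : List (Fin 21 → ℕ))
    (hcomplete : ∀ P, Valid21 rows P → κ P ≤ K →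
      (∃ P', GEquiv 3 21 P P' ∧ HK7Violating P') ∨ (∃ Q ∈ L, GEquiv 3 21 P Q))
    (hnone : ∀ Q ∈ L, ¬ Realizable21 Q)
    (P : Fin 21 → ℕ) (hnz : ∀ i, P i ≠ 0) (hlt : ∀ i, P i < 2 ^ 9) (hreal : Realizable21 P) :
    K + 1 ≤ κ P := by
  by_contra hK
  have hK' : κ P ≤ K := by omega
  have hvalid : Valid21 rows P := ⟨hnz, hlt, rowsOK_of_realizable21 hrows hreal⟩
  rcases hcomplete P hvalid hK' with ⟨P', hG, h7⟩ | ⟨Q, hQ, hG⟩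
  · exact not_realizable21_of_gEquiv_hk7 hG h7 hreal
  · exact hnone Q hQ (realizable_of_gEquiv hG hreal)

/-- Contrapositive reading: under the stratified hypotheses, a profile of 21 nonzero 9-bit patterns lying in a
CLOSED stratum (`κ P ≤ K`) is unrealizable. -/
theorem not_realizable21_of_stratified_census (κ : (Fin 21 → ℕ) → ℕ) (rows : List (List ℕ × ℕ))
    (hrows : ∀ r ∈ rows, Cert 3 3 3 r.1 r.2) (K : ℕ) (L : List (Fin 21 → ℕ))
    (hcomplete : ∀ P, Valid21 rows P → κ P ≤ K →
      (∃ P', GEquiv 3 21 P P' ∧ HK7Violating P') ∨ (∃ Q ∈ L, GEquiv 3 21 P Q))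
    (hnone : ∀ Q ∈ L, ¬ Realizable21 Q)
    (P : Fin 21 → ℕ) (hnz : ∀ i, P i ≠ 0) (hlt : ∀ i, P i < 2 ^ 9) (hκ : κ P ≤ K) :
    ¬ Realizable21 P := fun hreal => by
  have := stratum_gt_of_stratified_census κ rows hrows K L hcomplete hnone P hnz hlt hreal
  omega

/-- **The degenerate (full) case.**  If, besides the stratified hypotheses, NO valid profile lies in the open top
(`htop`: every `Valid21 rows` profile has `κ ≤ K`), the stratified census is a complete census and
`R_𝔽₂(⟨3,3,3⟩) ≥ 22` follows from `rankGe22_of_legal_census`.  (At the cell's 2026-08-23 cut `htop` fails for the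
rank-count stratification and all `K ≤ 8`.  Recorded for the logical shape only.) -/
theorem rankGe22_of_stratified_census_top (κ : (Fin 21 → ℕ) → ℕ) (rows : List (List ℕ × ℕ))
    (hrows : ∀ r ∈ rows, Cert 3 3 3 r.1 r.2) (K : ℕ) (L : List (Fin 21 → ℕ))
    (hcomplete : ∀ P, Valid21 rows P → κ P ≤ K →
      (∃ P', GEquiv 3 21 P P' ∧ HK7Violating P') ∨ (∃ Q ∈ L, GEquiv 3 21 P Q))
    (hnone : ∀ Q ∈ L, ¬ Realizable21 Q)
    (htop : ∀ P, Valid21 rows P → κ P ≤ K) :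
    22 ≤ tensorRank (matMulTensor (ZMod 2) 3 3 3) :=
  rankGe22_of_legal_census rows hrows L (fun P hP => hcomplete P hP (htop P hP)) hnone

end Summit.Ventures.MM22.Census22
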